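import Literature.MathematicalPhysics.QuantumFieldTheory.Balaban1983to89.T4EMLTangentInjective
import Summits.QuantumFields.YangMills.Theorems.BalabanUVNodesN08HaarCompatibilityGuardJacobianSharpFrame

/-!
# BalabanUVNodes ∕ N08 — OPERATOR-NORM BALLS OF `U(N)` ARE GEODESICALLY CONVEX; THE GUARD SET OF THE PRINTED FIBRE MAP CONTAINS THE
# GEODESIC BETWEEN ANY TWO OF ITS POINTS (every `N`; piece (i) of the general-`N` monotone height)

WIDTH SEAT `pub-ymgap-dag-n08-w6` g6 (R399 (3a); CLAIM-1 of record HOME INBOX l.38866), 2026-08-28.  Track A, DAG node N08 = [Balaban1985UV3] Thm 1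
p. 257 (compact) + Thm 2 p. 272; [Balaban1987RG1] (0.4) p. 253; key item K1⁷ `StabilityBAtRecordR13SepCoPH` (stmt-QuantumFields-20542), `--supports … --as
helper`.  COUNT-NEUTRAL.  n08-w3's part 26A `…GuardGeodesics` is the `S³` (quaternion, slerp) case; here every `U(N)` by a spectral argument.

THE MATHEMATICS ([folklore]).  (1) For a unitary `U` with `‖U − 1‖ ≤ d`: `Re⟨ξ, Uξ⟩ ≥ (1 − d²∕2)‖ξ‖²` (`‖(U − 1)ξ‖² = 2‖ξ‖² − 2Re⟨ξ,Uξ⟩`).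
(2) MIDPOINT LEMMA: `M`, `V` unitary, `‖V − 1‖ < √2`, `‖MV − 1‖ ≤ d`, `‖MV* − 1‖ ≤ d`, `d² ≤ 2` ⟹ `‖M − 1‖ ≤ d`.  Write `M = U diag(e^{−iθ}) U*`
(pub-balaban: every unitary is `exp(iA)`, `A` Hermitian — `MatrixLog.exists_isHermitian_exp_eq`; eigenframe of the skew `iA` — `T4EMLTangentInjective.frame`);
for the unit eigenvector `η` (column `a` of `U`, `Mη = μη`, `μ = e^{−iθₐ}`) test (1) for `MV` at `V*η` and for `MV*` at `Vη`:
`(1 − d²∕2) ≤ Re(μ·z̄)` and `≤ Re(μ·z)`, `z = ⟨η, Vη⟩`, so `(1 − d²∕2) ≤ Re μ · Re z` with `0 < Re z ≤ 1` (by (1) for `V`), whence `cos θₐ = Re μ ≥ 1 − d²∕2`,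
i.e. `|e^{−iθₐ} − 1| ≤ d` for every `a`, i.e. `‖M − 1‖ = ‖diag(e^{−iθ} − 1)‖ ≤ d`.  (3) Dyadic induction + closedness: for skew `x` with `‖exp(t x) − 1‖ < √2` on
`[0,1]`, `‖V₀ − 1‖ ≤ d` and `‖V₀eˣ − 1‖ ≤ d` give `‖V₀e^{tx} − 1‖ ≤ d` on `[0,1]` — **operator-norm balls in `U(N)` are geodesically convex**.  (4) THE GUARD:
for unitaries `hᵢ, u, u′` with `‖hᵢu* − 1‖ < δ`, `‖hᵢu′* − 1‖ < δ` (`δ ≤ 2∕5`) there is a skew-Hermitian `x` with `u·eˣ = u′`, `‖x‖ ≤ (π∕2)‖u − u′‖ < πδ`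
(`x = i·arg(u*u′)`), and **`‖hᵢ(u e^{tx})* − 1‖ < δ` for all `t ∈ [0,1]` and all `i`** — the whole geodesic is guarded, with the SAME `δ` (so the
monotone-height constants hold uniformly along it, for every `N`).

HONEST FRAMING.  Count-neutral [folklore] matrix analysis BY IMPORT (pub-balaban `MatrixLog`, `T4EMLTangentInjective`; Mathlib); NO injectivity ∕ (H_K) ∕
density statement here; nothing of Bałaban's asserted; E6′ NOT decided; `hmass` NOT supplied; N08 NOT discharged; counts unmoved (typed 28∕28 · discharged
5∕27); no summit statement is proved by this seat — one finite 𝕋⁴ programme at fixed ε, R4 closes the CONDITIONAL rung `BalabanLadder.UV` only; the Yang–Mills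
mass gap (Clay) is NOT proved by any of this; nothing continuum ∕ ℝ⁴ ∕ OS.  0 `sorry`, 0 `def`, 0 `instance`, 0 `notation`, standard axioms.
-/

noncomputable section

open NormedSpace Finset Set Filter
open scoped Matrix Matrix.Norms.L2Operator ComplexConjugate Nat InnerProductSpace Topology

namespace Summit.QuantumFields.YangMills.BalabanUVNodes.N08HaarCompatibilityGuardGeodesicConvex

open Literature.MathematicalPhysics.QuantumFieldTheory.Balaban1983to89
open Literature.MathematicalPhysics.QuantumFieldTheory.Balaban1983to89.T4EMLTangentInjective
open Summit.QuantumFields.YangMills.BalabanUVNodes.N08HaarCompatibilityGuardJacobianSharpFrame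
open Matrix (single diagonal unitaryGroup toEuclideanCLM)
open Complex (I)
open WithLp

variable {m : Type*} [Fintype m] [DecidableEq m]

/-! ## §1 Numerical range of a unitary near `1` -/

/-- Unitary matrices act isometrically on `EuclideanSpace`. [folklore] -/
theorem norm_toEuclideanCLM_unitary {U : Matrix m m ℂ} (hU : U ∈ unitaryGroup m ℂ) (ξ : EuclideanSpace ℂ m) :
    ‖toEuclideanCLM (n := m) (𝕜 := ℂ) U ξ‖ = ‖ξ‖ := by
  set T := toEuclideanCLM (n := m) (𝕜 := ℂ) U with hT
  have hadj : toEuclideanCLM (n := m) (𝕜 := ℂ) (star U) = ContinuousLinearMap.adjoint T := by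
    rw [map_star, ContinuousLinearMap.star_eq_adjoint]
  have h1 : ContinuousLinearMap.adjoint T * T = 1 := by
    rw [← hadj, hT, ← map_mul, Matrix.mem_unitaryGroup_iff'.mp hU, map_one]
  have h3 : ContinuousLinearMap.adjoint T (T ξ) = ξ := by simpa using congrArg (fun S : EuclideanSpace ℂ m →L[ℂ] EuclideanSpace ℂ m => S ξ) h1
  have h2 : ‖T ξ‖ ^ 2 = ‖ξ‖ ^ 2 := by
    rw [@norm_sq_eq_re_inner ℂ, ← ContinuousLinearMap.adjoint_inner_right, h3, @norm_sq_eq_re_inner ℂ]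
  nlinarith [norm_nonneg (T ξ), norm_nonneg ξ, sq_nonneg (‖T ξ‖ - ‖ξ‖), sq_nonneg (‖T ξ‖ + ‖ξ‖)]

/-- **(1)** For a unitary `U` with `‖U − 1‖ ≤ d`: `(1 − d²∕2)·‖ξ‖² ≤ Re⟨ξ, Uξ⟩` (`‖Uξ − ξ‖² = 2‖ξ‖² − 2Re⟨ξ,Uξ⟩ ≤ d²‖ξ‖²`). [folklore] -/
theorem re_inner_ge_of_norm_sub_one_le {U : Matrix m m ℂ} (hU : U ∈ unitaryGroup m ℂ) {d : ℝ} (hd : ‖U - 1‖ ≤ d)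
    (ξ : EuclideanSpace ℂ m) :
    (1 - d ^ 2 / 2) * ‖ξ‖ ^ 2 ≤ RCLike.re ⟪ξ, toEuclideanCLM (n := m) (𝕜 := ℂ) U ξ⟫_ℂ := by
  set T := toEuclideanCLM (n := m) (𝕜 := ℂ) U with hT
  have h0 : 0 ≤ d := (norm_nonneg _).trans hd
  have h1 : ‖T ξ - ξ‖ ≤ d * ‖ξ‖ := by
    rw [show T ξ - ξ = toEuclideanCLM (n := m) (𝕜 := ℂ) (U - 1) ξ by rw [map_sub, map_one]; rfl]
    exact (ContinuousLinearMap.le_opNorm _ _).trans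
      (mul_le_mul_of_nonneg_right (by rw [Matrix.l2_opNorm_toEuclideanCLM]; exact hd) (norm_nonneg _))
  have h2 : ‖T ξ - ξ‖ ^ 2 = 2 * ‖ξ‖ ^ 2 - 2 * RCLike.re ⟪ξ, T ξ⟫_ℂ := by
    rw [@norm_sub_sq ℂ, norm_toEuclideanCLM_unitary hU, inner_re_symm]; ring
  have h3 : ‖T ξ - ξ‖ ^ 2 ≤ (d * ‖ξ‖) ^ 2 := pow_le_pow_left₀ (norm_nonneg _) h1 2
  nlinarith

/-- `Re⟨ξ, Vξ⟩ ≤ ‖ξ‖²` for unitary `V` (Cauchy–Schwarz). [folklore] -/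
theorem re_inner_le_of_unitary {V : Matrix m m ℂ} (hV : V ∈ unitaryGroup m ℂ) (ξ : EuclideanSpace ℂ m) :
    RCLike.re ⟪ξ, toEuclideanCLM (n := m) (𝕜 := ℂ) V ξ⟫_ℂ ≤ ‖ξ‖ ^ 2 := by
  have h1 := norm_inner_le_norm (𝕜 := ℂ) ξ (toEuclideanCLM (n := m) (𝕜 := ℂ) V ξ); rw [norm_toEuclideanCLM_unitary hV] at h1
  have h2 := RCLike.re_le_norm (⟪ξ, toEuclideanCLM (n := m) (𝕜 := ℂ) V ξ⟫_ℂ)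
  nlinarith

/-! ## §2 A unitary eigenframe of a unitary matrix -/

/-- **Every unitary matrix is `U·diag(e^{−iθ})·U*`** for a unitary frame `U` (`M = exp(iA)`, `A` Hermitian — pub-balaban's
`MatrixLog.exists_isHermitian_exp_eq`; `T4EMLTangentInjective.frame` on the skew-Hermitian `iA`). [folklore] -/
theorem exists_unitary_frame [Nonempty m] {M : Matrix m m ℂ} (hM : M ∈ unitaryGroup m ℂ) :
    ∃ (U : Matrix m m ℂ) (θ : m → ℝ), star U * U = 1 ∧ U * star U = 1 ∧
      M = U * diagonal (fun a => Complex.exp (-I * (θ a : ℂ))) * star U := by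
  obtain ⟨A, hA, -, hexp, -, -⟩ := MatrixLog.exists_isHermitian_exp_eq hM
  set Z : Matrix m m ℂ := I • A with hZ
  have hZskew : Zᴴ = -Z := by
    rw [hZ, Matrix.conjTranspose_smul, hA.eq, Complex.star_def, Complex.conj_I, neg_smul]
  obtain ⟨U, θ, hU, hU', hZU, -⟩ := frame hZskew
  refine ⟨U, θ, hU, hU', ?_⟩
  have h1 := exp_mul_frame hU hU' θ hZU (1 : Matrix m m ℂ)
  simp only [Matrix.mul_one, hU, hexp] at h1
  rw [h1]; congr 2; ext a b
  simp only [Matrix.of_apply, Matrix.diagonal_apply, Matrix.one_apply]; split_ifs <;> simp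

/-- The columns of the frame are unit eigenvectors: with `η = U e_a`, `M η = e^{−iθₐ}·η` and `‖η‖ = 1`. [folklore] -/
theorem frame_column {U : Matrix m m ℂ} (hU : star U * U = 1) (θ : m → ℝ) {M : Matrix m m ℂ}
    (hMU : M = U * diagonal (fun a => Complex.exp (-I * (θ a : ℂ))) * star U) (a : m) :
    toEuclideanCLM (n := m) (𝕜 := ℂ) M (toLp 2 fun i => U i a) = Complex.exp (-I * (θ a : ℂ)) • toLp 2 (fun i => U i a) ∧
      ‖(toLp 2 fun i => U i a : EuclideanSpace ℂ m)‖ = 1 := by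
  constructor
  · rw [Matrix.toEuclideanCLM_toLp, ← WithLp.toLp_smul]; congr 1
    have hMU' : M * U = U * diagonal (fun a => Complex.exp (-I * (θ a : ℂ))) := by rw [hMU, Matrix.mul_assoc, hU, Matrix.mul_one]
    ext i
    have := congrFun (congrFun hMU' i) a
    rw [Matrix.mul_apply, Matrix.mul_diagonal] at this
    simpa [Matrix.mulVec, dotProduct, Pi.smul_apply, smul_eq_mul, mul_comm] using this
  · have h := congrFun (congrFun hU a) a
    rw [Matrix.mul_apply, Matrix.one_apply_eq] at h
    have h3 : ((∑ i, ‖U i a‖ ^ 2 : ℝ) : ℂ) = 1 := by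
      rw [← h]; push_cast
      exact Finset.sum_congr rfl fun i _ => by rw [Matrix.star_apply, Complex.star_def, Complex.conj_mul']
    have h4 : ∑ i, ‖U i a‖ ^ 2 = 1 := by exact_mod_cast h3
    rw [EuclideanSpace.norm_eq]; simp only [h4, Real.sqrt_one]

/-! ## §3 THE MIDPOINT LEMMA -/

/-- `Re(μ z) + Re(μ z̄) = 2·Re μ·Re z`. [folklore] -/
theorem re_mul_add_re_mul_conj (μ z : ℂ) : (μ * z).re + (μ * conj z).re = 2 * μ.re * z.re := by
  simp [Complex.mul_re, Complex.conj_re, Complex.conj_im]; ring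

/-- `|e^{−iθ} − 1|² = 2 − 2cos θ`. [folklore] -/
theorem norm_exp_neg_I_sub_one_sq (θ : ℝ) : ‖Complex.exp (-I * (θ : ℂ)) - 1‖ ^ 2 = 2 - 2 * Real.cos θ := by
  have h1 : Complex.exp (-I * (θ : ℂ)) = Complex.exp (I * ((-θ : ℝ) : ℂ)) := by push_cast; ring_nf
  rw [h1, Complex.norm_exp_I_mul_ofReal_sub_one, Real.norm_eq_abs, sq_abs, mul_pow, Real.sin_sq, Real.cos_sq,
    show 2 * (-θ / 2) = -θ by ring, Real.cos_neg]; ring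

/-- `Re e^{−iθ} = cos θ`. [folklore] -/
theorem exp_neg_I_re (θ : ℝ) : (Complex.exp (-I * (θ : ℂ))).re = Real.cos θ := by
  have h1 : Complex.exp (-I * (θ : ℂ)) = Complex.exp (((-θ : ℝ) : ℂ) * I) := by push_cast; ring_nf
  rw [h1, Complex.exp_ofReal_mul_I_re, Real.cos_neg]

/-- ★★ **THE MIDPOINT LEMMA.**  `M`, `V` unitary, `‖V − 1‖ < √2`, `‖M·V − 1‖ ≤ d`, `‖M·V* − 1‖ ≤ d`, `d² ≤ 2` ⟹ `‖M − 1‖ ≤ d`: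
the operator-norm ball `{‖· − 1‖ ≤ d}` of `U(N)` contains the geodesic midpoint `M` of its points `MV*`, `MV`. [folklore] -/
theorem norm_sub_one_le_of_midpoint [Nonempty m] {M V : Matrix m m ℂ} (hM : M ∈ unitaryGroup m ℂ) (hV : V ∈ unitaryGroup m ℂ)
    {d : ℝ} (hd2 : d ^ 2 ≤ 2) (hV1 : ‖V - 1‖ < Real.sqrt 2) (hp : ‖M * V - 1‖ ≤ d) (hm : ‖M * star V - 1‖ ≤ d) :
    ‖M - 1‖ ≤ d := by
  have hd0 : 0 ≤ d := (norm_nonneg _).trans hp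
  set c : ℝ := 1 - d ^ 2 / 2 with hc
  have hc0 : 0 ≤ c := by rw [hc]; linarith
  obtain ⟨U, θ, hU, hU', hMU⟩ := exists_unitary_frame hM
  have hUu : U ∈ unitaryGroup m ℂ := Matrix.mem_unitaryGroup_iff'.mpr hU
  -- each eigen-angle has `cos θₐ ≥ c`
  have hcos : ∀ a, c ≤ Real.cos (θ a) := by
    intro a
    obtain ⟨hη, hη1⟩ := frame_column hU θ hMU a
    set η : EuclideanSpace ℂ m := toLp 2 fun i => U i a
    set μ : ℂ := Complex.exp (-I * (θ a : ℂ))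
    set TV := toEuclideanCLM (n := m) (𝕜 := ℂ) V
    set TVs := toEuclideanCLM (n := m) (𝕜 := ℂ) (star V)
    have hVV : V * star V = 1 := Matrix.mem_unitaryGroup_iff.mp hV
    have hVV' : star V * V = 1 := Matrix.mem_unitaryGroup_iff'.mp hV
    have hsV : star V ∈ unitaryGroup m ℂ := Unitary.star_mem hV
    -- test (1) for `M V` at `V* η`
    have e1 : toEuclideanCLM (n := m) (𝕜 := ℂ) (M * V) (TVs η) = μ • η := by
      rw [← hη, ← ContinuousLinearMap.comp_apply]; congr 1
      rw [← ContinuousLinearMap.mul_def, ← map_mul, Matrix.mul_assoc, hVV, Matrix.mul_one]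
    have e2 : toEuclideanCLM (n := m) (𝕜 := ℂ) (M * star V) (TV η) = μ • η := by
      rw [← hη, ← ContinuousLinearMap.comp_apply]; congr 1
      rw [← ContinuousLinearMap.mul_def, ← map_mul, Matrix.mul_assoc, hVV', Matrix.mul_one]
    have i1 := re_inner_ge_of_norm_sub_one_le (mul_mem hM hV) hp (TVs η)
    have i2 := re_inner_ge_of_norm_sub_one_le (mul_mem hM hsV) hm (TV η)
    rw [e1, norm_toEuclideanCLM_unitary hsV, hη1, inner_smul_right, ← hc] at i1
    rw [e2, norm_toEuclideanCLM_unitary hV, hη1, inner_smul_right, ← hc] at i2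
    simp only [RCLike.re_to_complex, one_pow, mul_one] at i1 i2
    -- `⟨V*η, η⟩ = ⟨η, Vη⟩ =: z`, `⟨Vη, η⟩ = conj z`
    set z : ℂ := ⟪η, TV η⟫_ℂ with hz
    have hz1 : ⟪TVs η, η⟫_ℂ = z := by
      have hadj : TVs = ContinuousLinearMap.adjoint TV := by
        simp only [TVs, TV]; rw [map_star, ContinuousLinearMap.star_eq_adjoint]
      rw [hadj, ContinuousLinearMap.adjoint_inner_left]
    have hz2 : ⟪TV η, η⟫_ℂ = conj z := by rw [hz, inner_conj_symm]
    rw [hz1] at i1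
    rw [hz2] at i2
    have hsum := re_mul_add_re_mul_conj μ z
    have hzpos : 0 < z.re := by
      have h := re_inner_ge_of_norm_sub_one_le hV le_rfl η
      rw [hη1] at h; simp only [RCLike.re_to_complex, one_pow, mul_one] at h
      have h2 : ‖V - 1‖ ^ 2 < 2 := by
        have h0 : 0 ≤ ‖V - 1‖ := norm_nonneg _
        calc ‖V - 1‖ ^ 2 < Real.sqrt 2 ^ 2 := by gcongr
          _ = 2 := Real.sq_sqrt (by norm_num)
      have h3 : (1 - ‖V - 1‖ ^ 2 / 2) ≤ z.re := h
      linarith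
    have hzle : z.re ≤ 1 := by
      have := re_inner_le_of_unitary hV η
      rw [hη1] at this; simpa only [RCLike.re_to_complex, one_pow] using this
    have hμ : μ.re = Real.cos (θ a) := exp_neg_I_re (θ a)
    rw [← hμ]
    -- `c ≤ Re μ · Re z`, `0 < Re z ≤ 1`, `0 ≤ c`
    have key : c ≤ μ.re * z.re := by have := add_le_add i1 i2; nlinarith
    by_contra hlt; push Not at hlt
    nlinarith [mul_lt_mul_of_pos_right hlt hzpos, mul_le_mul_of_nonneg_left hzle hc0]
  -- hence `‖M − 1‖ = ‖diag(e^{−iθ} − 1)‖ ≤ d`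
  have hM1 : M - 1 = U * diagonal (fun a => Complex.exp (-I * (θ a : ℂ)) - 1) * star U := by
    rw [hMU, show (1 : Matrix m m ℂ) = U * Matrix.diagonal (fun _ => (1 : ℂ)) * star U by
        rw [Matrix.diagonal_one, Matrix.mul_one, hU'],
      ← Matrix.sub_mul, ← Matrix.mul_sub, Matrix.diagonal_sub]
  rw [hM1, CStarRing.norm_mul_mem_unitary _ (Unitary.star_mem hUu), CStarRing.norm_mem_unitary_mul _ hUu,
    Matrix.l2_opNorm_diagonal]
  refine (pi_norm_le_iff_of_nonneg hd0).2 fun a => ?_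
  have h1 : ‖Complex.exp (-I * (θ a : ℂ)) - 1‖ ^ 2 ≤ d ^ 2 := by
    rw [norm_exp_neg_I_sub_one_sq]; have := hcos a; rw [hc] at this; linarith
  exact (pow_le_pow_iff_left₀ (norm_nonneg _) hd0 two_ne_zero).mp h1

/-! ## §4 From the midpoint to the segment: operator-norm balls of `U(N)` are geodesically convex -/

section Segment

variable [Nonempty m]

omit [Fintype m] [DecidableEq m] [Nonempty m] in
/-- `star (t·x) = −(t·x)` for skew-Hermitian `x` and real `t`. [folklore] -/
theorem star_real_smul_skew {x : Matrix m m ℂ} (hx : xᴴ = -x) (t : ℝ) : star ((t : ℂ) • x) = -((t : ℂ) • x) := by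
  rw [star_smul, Matrix.star_eq_conjTranspose, hx, smul_neg, Complex.star_def, Complex.conj_ofReal]

omit [Nonempty m] in
/-- `exp(t·x)` is unitary for skew-Hermitian `x`, real `t`. [folklore] -/
theorem exp_smul_mem_unitaryGroup {x : Matrix m m ℂ} (hx : xᴴ = -x) (t : ℝ) :
    exp ((t : ℂ) • x) ∈ unitaryGroup m ℂ := by
  letI : NormedAlgebra ℚ (Matrix m m ℂ) := NormedAlgebra.restrictScalars ℚ ℂ (Matrix m m ℂ)
  exact NormedSpace.exp_mem_unitary_of_mem_skewAdjoint (skewAdjoint.mem_iff.mpr (star_real_smul_skew hx t))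

omit [Nonempty m] in
/-- `exp((s+t)·x) = exp(s·x)·exp(t·x)`. [folklore] -/
theorem exp_add_smul (x : Matrix m m ℂ) (s t : ℝ) :
    exp (((s + t : ℝ) : ℂ) • x) = exp ((s : ℂ) • x) * exp ((t : ℂ) • x) := by
  letI : NormedAlgebra ℚ (Matrix m m ℂ) := NormedAlgebra.restrictScalars ℚ ℂ (Matrix m m ℂ)
  rw [Complex.ofReal_add, add_smul]
  exact exp_add_of_commute (((Commute.refl x).smul_left _).smul_right _)

omit [Nonempty m] in
/-- `‖exp(−t·x) − 1‖ = ‖exp(t·x) − 1‖` for skew-Hermitian `x` (`exp(−tx) = exp(tx)*`). [folklore] -/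
theorem norm_exp_neg_smul_sub_one {x : Matrix m m ℂ} (hx : xᴴ = -x) (t : ℝ) :
    ‖exp (((-t : ℝ) : ℂ) • x) - 1‖ = ‖exp ((t : ℂ) • x) - 1‖ := by
  letI : NormedAlgebra ℚ (Matrix m m ℂ) := NormedAlgebra.restrictScalars ℚ ℂ (Matrix m m ℂ)
  have h1 : exp (((-t : ℝ) : ℂ) • x) = star (exp ((t : ℂ) • x)) := by
    rw [star_exp, star_real_smul_skew hx, Complex.ofReal_neg, neg_smul]
  rw [h1, ← Matrix.l2_opNorm_conjTranspose (exp ((t : ℂ) • x) - 1), ← Matrix.star_eq_conjTranspose, star_sub, star_one]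

/-- ★★★ **OPERATOR-NORM BALLS OF `U(N)` ARE GEODESICALLY CONVEX.**  `V₀` unitary, `x` skew-Hermitian with `‖exp(t·x) − 1‖ < √2` on
`t ∈ [0,1]`, `d² ≤ 2`: if `‖V₀ − 1‖ ≤ d` and `‖V₀·eˣ − 1‖ ≤ d` then `‖V₀·e^{t x} − 1‖ ≤ d` for every `t ∈ [0,1]`.
PROOF.  The set `S = {t : ‖V₀e^{tx} − 1‖ ≤ d}` is closed and, by the midpoint lemma (`M = V₀e^{(s+t)x∕2}`, `V = e^{(t−s)x∕2}`), midpoint-closed on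
`[0,1]`; induction over dyadic rationals and density. [folklore] -/
theorem norm_mul_exp_smul_sub_one_le {V₀ x : Matrix m m ℂ} (hV₀ : V₀ ∈ unitaryGroup m ℂ) (hx : xᴴ = -x) {d : ℝ}
    (hd2 : d ^ 2 ≤ 2) (hxs : ∀ t ∈ Icc (0 : ℝ) 1, ‖exp ((t : ℂ) • x) - 1‖ < Real.sqrt 2)
    (h0 : ‖V₀ - 1‖ ≤ d) (h1 : ‖V₀ * exp x - 1‖ ≤ d) :
    ∀ t ∈ Icc (0 : ℝ) 1, ‖V₀ * exp ((t : ℂ) • x) - 1‖ ≤ d := by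
  letI : NormedAlgebra ℚ (Matrix m m ℂ) := NormedAlgebra.restrictScalars ℚ ℂ (Matrix m m ℂ)
  set S : Set ℝ := {t | ‖V₀ * exp ((t : ℂ) • x) - 1‖ ≤ d} with hS
  have hSclosed : IsClosed S := by
    have hc : Continuous fun t : ℝ => ‖V₀ * exp ((t : ℂ) • x) - 1‖ :=
      ((continuous_const.mul (NormedSpace.exp_continuous.comp
        (Complex.continuous_ofReal.smul continuous_const))).sub continuous_const).norm
    exact isClosed_le hc continuous_const
  -- midpoint closure on `[0,1]`
  have hmid : ∀ s t, s ∈ Icc (0 : ℝ) 1 → t ∈ Icc (0 : ℝ) 1 → s ∈ S → t ∈ S → (s + t) / 2 ∈ S := by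
    intro s t hs ht hsS htS
    have hM : V₀ * exp ((((s + t) / 2 : ℝ) : ℂ) • x) ∈ unitaryGroup m ℂ := mul_mem hV₀ (exp_smul_mem_unitaryGroup hx _)
    have hV : exp ((((t - s) / 2 : ℝ) : ℂ) • x) ∈ unitaryGroup m ℂ := exp_smul_mem_unitaryGroup hx _
    have hp : V₀ * exp ((((s + t) / 2 : ℝ) : ℂ) • x) * exp ((((t - s) / 2 : ℝ) : ℂ) • x) = V₀ * exp ((t : ℂ) • x) := by
      rw [Matrix.mul_assoc, ← exp_add_smul, show (s + t) / 2 + (t - s) / 2 = t by ring]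
    have hm : V₀ * exp ((((s + t) / 2 : ℝ) : ℂ) • x) * star (exp ((((t - s) / 2 : ℝ) : ℂ) • x))
        = V₀ * exp ((s : ℂ) • x) := by
      rw [star_exp, star_real_smul_skew hx, ← neg_smul, ← Complex.ofReal_neg, Matrix.mul_assoc, ← exp_add_smul,
        show (s + t) / 2 + -((t - s) / 2) = s by ring]
    have hV1 : ‖exp ((((t - s) / 2 : ℝ) : ℂ) • x) - 1‖ < Real.sqrt 2 := by
      by_cases hst : s ≤ t
      · exact hxs _ ⟨by linarith [hs.1, ht.1, hs.2, ht.2], by linarith [hs.1, ht.1, hs.2, ht.2]⟩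
      · rw [show (t - s) / 2 = -((s - t) / 2) by ring, norm_exp_neg_smul_sub_one hx]
        exact hxs _ ⟨by linarith, by linarith [hs.1, ht.1, hs.2, ht.2]⟩
    show ‖V₀ * exp ((((s + t) / 2 : ℝ) : ℂ) • x) - 1‖ ≤ d
    exact norm_sub_one_le_of_midpoint hM hV hd2 hV1 (by rw [hp]; exact htS) (by rw [hm]; exact hsS)
  -- dyadic rationals of `[0,1]`
  have hdy : ∀ n k : ℕ, k ≤ 2 ^ n → ((k : ℝ) / 2 ^ n) ∈ S := by
    intro n
    induction n with
    | zero =>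
      intro k hk
      rw [pow_zero] at hk
      interval_cases k
      · rw [show ((0 : ℕ) : ℝ) / 2 ^ 0 = 0 by norm_num]; show ‖V₀ * exp (((0 : ℝ) : ℂ) • x) - 1‖ ≤ d; simpa using h0
      · rw [show ((1 : ℕ) : ℝ) / 2 ^ 0 = 1 by norm_num]; show ‖V₀ * exp (((1 : ℝ) : ℂ) • x) - 1‖ ≤ d; simpa using h1
    | succ n ih =>
      intro k hk
      rcases Nat.even_or_odd k with ⟨j, rfl⟩ | ⟨j, rfl⟩
      · have hj : j ≤ 2 ^ n := by rw [pow_succ] at hk; omega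
        rw [show (((j + j : ℕ) : ℝ) / 2 ^ (n + 1)) = (j : ℝ) / 2 ^ n by push_cast; rw [pow_succ]; field_simp; ring]
        exact ih j hj
      · have hj1 : j + 1 ≤ 2 ^ n := by rw [pow_succ] at hk; omega
        have hj : j ≤ 2 ^ n := by omega
        have e : ((2 * j + 1 : ℕ) : ℝ) / 2 ^ (n + 1) = ((j : ℝ) / 2 ^ n + ((j + 1 : ℕ) : ℝ) / 2 ^ n) / 2 := by
          push_cast; rw [pow_succ]; field_simp; ring
        rw [e]
        have h2n : (0 : ℝ) < 2 ^ n := by positivity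
        refine hmid _ _ ⟨by positivity, ?_⟩ ⟨by positivity, ?_⟩ (ih j hj) (ih (j + 1) hj1)
        · rw [div_le_one h2n]; exact_mod_cast hj
        · rw [div_le_one h2n]; exact_mod_cast hj1
  -- density of the dyadics
  intro t ht
  have hle : ∀ n : ℕ, ((⌊t * 2 ^ n⌋₊ : ℕ) : ℝ) / 2 ^ n ≤ t := fun n => by
    rw [div_le_iff₀ (by positivity)]
    exact Nat.floor_le (by have := ht.1; positivity)
  have hge : ∀ n : ℕ, t - (1 / 2) ^ n ≤ ((⌊t * 2 ^ n⌋₊ : ℕ) : ℝ) / 2 ^ n := fun n => by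
    rw [le_div_iff₀ (by positivity), sub_mul, one_div_pow, div_mul_cancel₀ _ (by positivity)]
    have := Nat.lt_floor_add_one (t * 2 ^ n)
    linarith
  have hlim : Tendsto (fun n : ℕ => ((⌊t * 2 ^ n⌋₊ : ℕ) : ℝ) / 2 ^ n) atTop (𝓝 t) := by
    have hlow : Tendsto (fun n : ℕ => t - (1 / 2 : ℝ) ^ n) atTop (𝓝 t) := by
      have := (tendsto_pow_atTop_nhds_zero_of_lt_one (by norm_num : (0 : ℝ) ≤ 1 / 2) (by norm_num)).const_sub t
      simpa using this
    exact tendsto_of_tendsto_of_tendsto_of_le_of_le hlow tendsto_const_nhds hge hle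
  exact hSclosed.mem_of_tendsto hlim (Eventually.of_forall fun n => hdy n _ (Nat.floor_le_of_le (by
    have := ht.2; push_cast; nlinarith [pow_pos (show (0:ℝ) < 2 by norm_num) n])))

end Segment

/-! ## §5 THE GUARD SET CONTAINS ITS GEODESICS -/

/-- `‖h·w* − 1‖ = ‖h*·w − 1‖` for unitary `h` (left-translate to the identity). [folklore] -/
theorem norm_guard_eq {h : Matrix m m ℂ} (hh : h ∈ unitaryGroup m ℂ) (w : Matrix m m ℂ) :
    ‖h * star w - 1‖ = ‖star h * w - 1‖ := by
  have h1 : ‖h * star w - 1‖ = ‖w * star h - 1‖ := by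
    rw [← Matrix.l2_opNorm_conjTranspose (h * star w - 1), ← Matrix.star_eq_conjTranspose, star_sub, star_mul, star_star, star_one]
  have h2 : star h * (w * star h - 1) * h = star h * w - 1 := by
    rw [Matrix.mul_sub, Matrix.sub_mul, Matrix.mul_one, Matrix.mul_assoc, Matrix.mul_assoc,
      Matrix.mem_unitaryGroup_iff'.mp hh, Matrix.mul_one]
  rw [h1, ← h2, CStarRing.norm_mul_mem_unitary _ hh, CStarRing.norm_mem_unitary_mul _ (Unitary.star_mem hh)]

/-- Two points of one guard ball are `2δ`-close: `‖hu* − 1‖ < δ`, `‖hu′* − 1‖ < δ` ⇒ `‖u − u′‖ < 2δ` (`h` unitary). [folklore] -/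
theorem norm_sub_lt_two_mul_of_guard {h u u' : Matrix m m ℂ} (hh : h ∈ unitaryGroup m ℂ) {δ : ℝ}
    (hg : ‖h * star u - 1‖ < δ) (hg' : ‖h * star u' - 1‖ < δ) : ‖u - u'‖ < 2 * δ := by
  have e0 : ∀ v : Matrix m m ℂ, ‖h * star v - 1‖ = ‖v - h‖ := fun v => by
    rw [norm_guard_eq hh, show star h * v - 1 = star h * (v - h) by
      rw [Matrix.mul_sub, Matrix.mem_unitaryGroup_iff'.mp hh], CStarRing.norm_mem_unitary_mul _ (Unitary.star_mem hh)]
  calc ‖u - u'‖ = ‖(u - h) + (h - u')‖ := by rw [sub_add_sub_cancel]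
    _ ≤ ‖u - h‖ + ‖h - u'‖ := norm_add_le _ _
    _ < δ + δ := by rw [← e0 u, ← norm_neg (h - u'), neg_sub, ← e0 u']; exact add_lt_add hg hg'
    _ = 2 * δ := two_mul δ |>.symm

/-- ★★★ **THE GUARD SET OF THE PRINTED FIBRE MAP CONTAINS THE GEODESIC BETWEEN ANY TWO OF ITS POINTS, EVERY `N`.**
For unitaries `hᵢ`, `u`, `u′` with `‖hᵢu* − 1‖ < δ`, `‖hᵢu′* − 1‖ < δ` for all `i`, `δ ≤ 2∕5`: there is a skew-Hermitian `x` with `u·eˣ = u′`,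
`‖x‖ ≤ (π∕2)·‖u − u′‖` (`x = i·arg(u*u′)`, pub-balaban's `exists_isHermitian_exp_eq`), such that along the geodesic `w_t = u·e^{t x}`, `t ∈ [0,1]`:
`w_t` is unitary and `‖hᵢw_t* − 1‖ < δ` for every `i` (§4 at `V₀ = hᵢ*u`; `‖e^{tx} − 1‖ ≤ ‖x‖ < πδ < √2`). [folklore] -/
theorem guard_geodesic [Nonempty m] {ι : Type*} {h : ι → Matrix m m ℂ} (hh : ∀ i, h i ∈ unitaryGroup m ℂ)
    {u u' : Matrix m m ℂ} (hu : u ∈ unitaryGroup m ℂ) (hu' : u' ∈ unitaryGroup m ℂ) {δ : ℝ} (hδ : δ ≤ 2 / 5)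
    (hg : ∀ i, ‖h i * star u - 1‖ < δ) (hg' : ∀ i, ‖h i * star u' - 1‖ < δ) :
    ∃ x : Matrix m m ℂ, xᴴ = -x ∧ u * exp x = u' ∧ ‖x‖ ≤ Real.pi / 2 * ‖u - u'‖ ∧
      ∀ t ∈ Icc (0 : ℝ) 1, u * exp ((t : ℂ) • x) ∈ unitaryGroup m ℂ ∧ ∀ i, ‖h i * star (u * exp ((t : ℂ) • x)) - 1‖ < δ := by
  have hW : star u * u' ∈ unitaryGroup m ℂ := mul_mem (Unitary.star_mem hu) hu'
  obtain ⟨A, hA, hAπ, hexpA, -, hle⟩ := MatrixLog.exists_isHermitian_exp_eq hW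
  have hdist : UnitaryModel.opDist1 (star u * u') = ‖u - u'‖ := by
    show ‖star u * u' - 1‖ = ‖u - u'‖
    have e : star u * u' - 1 = star u * (u' - u) := by
      rw [Matrix.mul_sub, Matrix.mem_unitaryGroup_iff'.mp hu]
    rw [e, CStarRing.norm_mem_unitary_mul _ (Unitary.star_mem hu), ← norm_neg, neg_sub]
  set x : Matrix m m ℂ := I • A with hxdef
  have hx : xᴴ = -x := by
    rw [hxdef, Matrix.conjTranspose_smul, hA.eq, Complex.star_def, Complex.conj_I, neg_smul]
  have hnx : ‖x‖ = ‖A‖ := by rw [hxdef, norm_smul, Complex.norm_I, one_mul]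
  have hux : u * exp x = u' := by
    rw [hxdef, hexpA, ← Matrix.mul_assoc, Matrix.mem_unitaryGroup_iff.mp hu, Matrix.one_mul]
  refine ⟨x, hx, hux, by rw [hnx, ← hdist]; exact hle, fun t ht => ⟨mul_mem hu (exp_smul_mem_unitaryGroup hx t), fun i => ?_⟩⟩
  -- the guard along the geodesic, at `V₀ = hᵢ* u`
  have hδuu : ‖u - u'‖ < 2 * δ := norm_sub_lt_two_mul_of_guard (hh i) (hg i) (hg' i)
  have hxs : ∀ τ ∈ Icc (0 : ℝ) 1, ‖exp ((τ : ℂ) • x) - 1‖ < Real.sqrt 2 := by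
    intro τ hτ
    have hτA : ((τ : ℂ) • A).IsHermitian := by
      rw [Matrix.IsHermitian, Matrix.conjTranspose_smul, hA.eq, Complex.star_def, Complex.conj_ofReal]
    have h1 : ‖exp ((τ : ℂ) • x) - 1‖ ≤ ‖(τ : ℂ) • A‖ := by rw [hxdef, smul_comm]; exact MatrixLog.opDist1_exp_le hτA
    have h2 : ‖(τ : ℂ) • A‖ ≤ ‖A‖ := by
      rw [norm_smul, Complex.norm_real, Real.norm_of_nonneg hτ.1]
      exact mul_le_of_le_one_left (norm_nonneg _) hτ.2
    have h3 : ‖A‖ < Real.sqrt 2 := by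
      have hπ := Real.pi_lt_d2
      have h4 : ‖A‖ < Real.pi / 2 * (2 * δ) := by
        rw [← hdist] at hδuu; exact hle.trans_lt (by nlinarith [Real.pi_pos])
      have h5 : Real.pi / 2 * (2 * δ) ≤ 1.26 := by nlinarith [mul_nonneg Real.pi_pos.le (sub_nonneg.2 hδ)]
      have h6 : (1.26 : ℝ) < Real.sqrt 2 := by rw [Real.lt_sqrt (by norm_num)]; norm_num
      linarith
    linarith
  have hV₀ : star (h i) * u ∈ unitaryGroup m ℂ := mul_mem (Unitary.star_mem (hh i)) hu
  have hA0 : ‖star (h i) * u - 1‖ < δ := by rw [← norm_guard_eq (hh i)]; exact hg i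
  have hA1 : ‖star (h i) * u * exp x - 1‖ < δ := by
    rw [Matrix.mul_assoc, hux, ← norm_guard_eq (hh i)]; exact hg' i
  have hdδ : max ‖star (h i) * u - 1‖ ‖star (h i) * u * exp x - 1‖ < δ := max_lt hA0 hA1
  have hd2 : (max ‖star (h i) * u - 1‖ ‖star (h i) * u * exp x - 1‖) ^ 2 ≤ 2 := by
    have hd0 : 0 ≤ max ‖star (h i) * u - 1‖ ‖star (h i) * u * exp x - 1‖ := le_max_of_le_left (norm_nonneg _)
    nlinarith
  have key := norm_mul_exp_smul_sub_one_le hV₀ hx hd2 hxs (le_max_left _ _) (le_max_right _ _) t ht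
  rw [norm_guard_eq (hh i), ← Matrix.mul_assoc]
  exact key.trans_lt hdδ

end Summit.QuantumFields.YangMills.BalabanUVNodes.N08HaarCompatibilityGuardGeodesicConvex
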